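import Summits.ValiantsHypothesis.ValiantsHypothesis.Theorems.BarrierLeverTropicalDetCertificatesExistNearPrincipal
import Summits.ValiantsHypothesis.ValiantsHypothesis.Theorems.BarrierLeverTropicalDetCertificateSuffices

/-!
# Route BarrierLever — item `TransversalMinorLayoutsNonsingular` (TT, stmt-ValiantsHypothesis-19152)
# holds UNCONDITIONALLY on layouts at exchange distance ≤ 1

Helper file (`--supports stmt-ValiantsHypothesis-19152`; cell valiant-natproofs, rung V4, 𝒟-side;
prover seat val-np-p1). Closes NO item. One arrow assembling two tree theorems: item 19448
(`…NearPrincipal.tropicalDetCertificatesExistNearPrincipal`: a tropical-determinant certificate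
`(D, π₀)` EXISTS for every injective layout whose row points, all but one, reappear among the column
points) and item 19315 (`…TropicalDet.tropicalDetCertificateSuffices`: such a certificate forces the
transversal layout minor to be nonzero for some `H`). Hence the conclusion of TT,
`∃ H : Matrix (Fin (h+h)) (Fin (h+h)) ℂ, det (det H[ρ_{u i}, τ_{w j}])_{i,j} ≠ 0`, holds for every
such NEAR-PRINCIPAL layout (`transversalMinor_nonsingular_of_nearPrincipal`) — in particular for
every principal layout (`u = w ∘ π`, `transversalMinor_nonsingular_of_principal`).

WHAT THIS IS NOT: TT (item 19152) asks this for ALL injective layouts and stays OPEN; nothing on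
TNS / item 19717 layout-wise (the arrow TT → TNS, item 19153, is global), on crux
stmt-ValiantsHypothesis-14610, or on `VP` versus `VNP`.
-/

-- layout Summits/ValiantsHypothesis/ValiantsHypothesis forces the duplicated namespace component
set_option linter.dupNamespace false

namespace Summit.ValiantsHypothesis.ValiantsHypothesis.Theorems.BarrierLever.NearPrincipal

/-- **TT on near-principal layouts (unconditional).** If `u, w : Fin r → Finset (Fin h)` are
injective and all row points but `u i₀` reappear among the column points other than `w j₀`, then
some `H : Matrix (Fin (h+h)) (Fin (h+h)) ℂ` makes the transversal layout matrix
`(det H[ρ_{u i}, τ_{w j}])_{i,j}` nonsingular (items 19448 + 19315). -/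
theorem transversalMinor_nonsingular_of_nearPrincipal (h r : ℕ) (u w : Fin r → Finset (Fin h))
    (hu : Function.Injective u) (hw : Function.Injective w)
    (hnear : ∃ i₀ j₀ : Fin r, ∀ i, i ≠ i₀ → ∃ j, j ≠ j₀ ∧ w j = u i) :
    ∃ H : Matrix (Fin (h + h)) (Fin (h + h)) ℂ, (Matrix.of fun i j : Fin r =>
      (H.submatrix (fun a : Fin h => if a ∈ u i then Fin.castAdd h a else Fin.natAdd h a)
        (fun c : Fin h => if c ∈ w j then Fin.natAdd h c else Fin.castAdd h c)).det).det ≠ 0 := by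
  obtain ⟨D, π₀, hπ⟩ := tropicalDetCertificatesExistNearPrincipal h r u w hu hw hnear
  exact TropicalDet.tropicalDetCertificateSuffices h r u w D _ (fun _ _ => rfl) π₀ hπ

/-- **TT on principal layouts (unconditional).** If the column points are the row points up to a
relabelling (`u = w ∘ π`, `w` injective, `r ≥ 1`), the transversal layout matrix is nonsingular for
some `H`. (For `r = 0` the `0 × 0` determinant is `1`; stated for `0 < r` to produce the indices the
near-principal hypothesis quantifies over.) -/
theorem transversalMinor_nonsingular_of_principal (h r : ℕ) (hr : 0 < r)
    (w : Fin r → Finset (Fin h)) (hw : Function.Injective w) (π : Equiv.Perm (Fin r)) :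
    ∃ H : Matrix (Fin (h + h)) (Fin (h + h)) ℂ, (Matrix.of fun i j : Fin r =>
      (H.submatrix (fun a : Fin h => if a ∈ (w ∘ π) i then Fin.castAdd h a else Fin.natAdd h a)
        (fun c : Fin h => if c ∈ w j then Fin.natAdd h c else Fin.castAdd h c)).det).det ≠ 0 := by
  refine transversalMinor_nonsingular_of_nearPrincipal h r (w ∘ π) w (hw.comp π.injective) hw
    ⟨⟨0, hr⟩, π ⟨0, hr⟩, fun i hi => ⟨π i, fun heq => hi (π.injective heq), rfl⟩⟩

end Summit.ValiantsHypothesis.ValiantsHypothesis.Theorems.BarrierLever.NearPrincipal
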